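import Summits.QuantumFields.YangMills.Theorems.ColdStartUniversalityLatticeLangevinWilsonAutocorrelationToGap
import Summits.QuantumFields.YangMills.Theorems.ColdStartUniversalityLatticeLangevinWilsonContractionAtOneTime
import Summits.QuantumFields.YangMills.Theorems.ColdStartUniversalityLatticeLangevinWilsonAutocorrelationOfDecay
import HarnessLib

/-!
# Route `ColdStartUniversality` (fixed-cut-off `L²(μ_{β'})` package): FOUR EQUIVALENT FORMS OF AN `L²` SPECTRAL GAP `λ` for the
# reversible SZZ dynamics — one `List.TFAE`, same constant throughout, kernel-checked by convexity alone

Helper file (seat `ym-line-csu-p1`, g17; `--supports stmt-QuantumFields-27363`).  Capstone of the semigroup-form Poincaré package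
(`…WilsonSemigroupConvexity/Poincare/PoincareSmoothing`, `…AutocorrelationLogConvex/ToGap/OfDecay`, `…ContractionAtOneTime`).  For every
`L, β'`, every Markov kernel family realising the SU(2) SZZ transition laws, and every rate `λ > 0`, the following are EQUIVALENT
(continuous observables `G`, `G₀ = G − μG`, `μ = μ_{β'}` the Wilson measure):

  (1) `∫ (κ_t G − μG)² dμ ≤ e^{−2λt} Var_μ(G)` for all `G`, all lattice times `t`            [(H1)-shape: `L²` decay at rate `λ`];
  (2) the same at ONE lattice time `h₀ > 0`                                                  [one-lag autocovariance bound];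
  (3) for all `G`, `η > 0` some `h > 0` has `(λ − η) Var_μ(G) ≤ h⁻¹(∫G² dμ − ∫ Gκ_hG dμ)`     [Poincaré for the semigroup Dirichlet form];
  (4) `∫₀^{T'} ⟨G₀, κ_t G₀⟩_μ dt ≤ λ⁻¹ Var_μ(G)` for all `G`, all horizons `T' ≥ 0`            [uniform bound on integrated autocorrelations].

* ★★ `wilson_l2Gap_tfae` — `List.TFAE [(1), (2), (3), (4)]` ((1)⇒(2) trivial; (2)⇒(3) `semigroupPoincare_of_contraction_at`; (3)⇒(1)
  `integral_sq_transition_sub_le_exp_of_semigroupPoincare`; (1)⇒(4) `autocorrelation_integral_le_of_integral_sq_transition_sub_le_exp`;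
  (4)⇒(3) `semigroupPoincare_of_autocorrelation_integral_le`).

Textbook route: spectral theorem for the self-adjoint generator (Bakry–Gentil–Ledoux Thm 4.2.5, §4.2).  Here: no generator, no core, no spectral
measure — midpoint (log-)convexity of `u ↦ ⟨G₀, κ_uG₀⟩_μ` (Chapman–Kolmogorov + reversibility + Cauchy–Schwarz) and elementary real analysis.
Read at `λ = c ε_K` these are four interchangeable typings of the K-uniform hypothesis (H1) of the `L²` line (`…UniformColdStartMixingOf…`).
THEOREMS ONLY, no definition, no sorry.  HONEST FRAMING: RECORD-rung R3 plumbing at FIXED cut-off; nothing K-uniform is proved; no crux, rung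
or summit statement is proved; the Yang–Mills mass gap is NOT proved.
-/

set_option autoImplicit false

noncomputable section

namespace Summit.QuantumFields.YangMills.Theorems.ColdStartUniversality

open MeasureTheory ProbabilityTheory Filter Set Topology
open scoped BigOperators NNReal ENNReal
open Literature.Probability.Process Literature.MathematicalPhysics.QuantumFieldTheory
open Literature.MathematicalPhysics.QuantumLattice (fundamentalRep fundamentalLatticeRep continuous_fundamentalRep)

/-- ★★ **Four equivalent forms of an `L²(μ_{β'})` spectral gap `λ > 0` for the reversible SZZ dynamics at fixed cut-off**: decay at all
times ⟺ decay at one time ⟺ Poincaré inequality for the semigroup Dirichlet form ⟺ uniform bound `1/λ` on integrated autocorrelations —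
same constant throughout. [cite: BakryGentilLedoux2014, Thm 4.2.5 with Remark 4.3.3 and §4.2] -/
theorem wilson_l2Gap_tfae (L : ℕ) [NeZero L] (β' : ℝ)
    (κ : ℝ≥0 → Kernel (GaugeConfig 3 L (Matrix.specialUnitaryGroup (Fin 2) ℂ))
      (GaugeConfig 3 L (Matrix.specialUnitaryGroup (Fin 2) ℂ))) [∀ t, IsMarkovKernel (κ t)]
    (hreal : ∀ (t : ℝ≥0) (x : GaugeConfig 3 L (Matrix.specialUnitaryGroup (Fin 2) ℂ))
        (Ω : Type) [MeasurableSpace Ω] (P : Measure Ω) [IsProbabilityMeasure P]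
        (W : ℝ≥0 → Ω → (Edge 3 L × NoiseIdx 2 → ℝ)) (hW : IsFlatBrownian W P)
        (U : ℝ≥0 → Ω → GaugeConfig 3 L (Matrix.specialUnitaryGroup (Fin 2) ℂ)),
        (∀ ω, U 0 ω = x) →
        (latticeLangevinDynamics (fundamentalLatticeRep 2) β').IsSolution (fundamentalRep (Fin 2))
          hW.natFiltration P W U →
        κ t x = P.map (U t))
    {lam : ℝ} (hlam : 0 < lam) :
    List.TFAE [
      -- (1) `L²` decay at rate `λ` at all times
      ∀ G : GaugeConfig 3 L (Matrix.specialUnitaryGroup (Fin 2) ℂ) → ℝ, Continuous G → ∀ t : ℝ≥0,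
        ∫ x, ((∫ y, G y ∂(κ t x)) - ∫ z, G z ∂(wilsonMeasure (d := 3) (L := L) (fundamentalRep (Fin 2)) β')) ^ 2
            ∂(wilsonMeasure (d := 3) (L := L) (fundamentalRep (Fin 2)) β') ≤
          Real.exp (-2 * lam * t) *
            ∫ x, (G x - ∫ z, G z ∂(wilsonMeasure (d := 3) (L := L) (fundamentalRep (Fin 2)) β')) ^ 2
              ∂(wilsonMeasure (d := 3) (L := L) (fundamentalRep (Fin 2)) β'),
      -- (2) `L²` contraction at one time
      ∃ h₀ : ℝ≥0, 0 < h₀ ∧ ∀ G : GaugeConfig 3 L (Matrix.specialUnitaryGroup (Fin 2) ℂ) → ℝ, Continuous G →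
        ∫ x, ((∫ y, G y ∂(κ h₀ x)) - ∫ z, G z ∂(wilsonMeasure (d := 3) (L := L) (fundamentalRep (Fin 2)) β')) ^ 2
            ∂(wilsonMeasure (d := 3) (L := L) (fundamentalRep (Fin 2)) β') ≤
          Real.exp (-2 * lam * h₀) *
            ∫ x, (G x - ∫ z, G z ∂(wilsonMeasure (d := 3) (L := L) (fundamentalRep (Fin 2)) β')) ^ 2
              ∂(wilsonMeasure (d := 3) (L := L) (fundamentalRep (Fin 2)) β'),
      -- (3) Poincaré inequality for the semigroup Dirichlet form, constant `1/λ`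
      ∀ G : GaugeConfig 3 L (Matrix.specialUnitaryGroup (Fin 2) ℂ) → ℝ, Continuous G → ∀ η : ℝ, 0 < η →
        ∃ h : ℝ≥0, 0 < h ∧
          (lam - η) * ∫ x, (G x - ∫ z, G z ∂(wilsonMeasure (d := 3) (L := L) (fundamentalRep (Fin 2)) β')) ^ 2
              ∂(wilsonMeasure (d := 3) (L := L) (fundamentalRep (Fin 2)) β') ≤
            (h : ℝ)⁻¹ * ((∫ x, G x * G x ∂(wilsonMeasure (d := 3) (L := L) (fundamentalRep (Fin 2)) β')) -
              ∫ x, G x * (∫ y, G y ∂(κ h x)) ∂(wilsonMeasure (d := 3) (L := L) (fundamentalRep (Fin 2)) β')),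
      -- (4) uniform bound `1/λ` on integrated autocorrelations
      ∀ G : GaugeConfig 3 L (Matrix.specialUnitaryGroup (Fin 2) ℂ) → ℝ, Continuous G → ∀ T' : ℝ, 0 ≤ T' →
        ∫ t in (0 : ℝ)..T', ∫ x, (G x - ∫ z, G z ∂(wilsonMeasure (d := 3) (L := L) (fundamentalRep (Fin 2)) β')) *
            ((∫ y, G y ∂(κ t.toNNReal x)) - ∫ z, G z ∂(wilsonMeasure (d := 3) (L := L) (fundamentalRep (Fin 2)) β'))
            ∂(wilsonMeasure (d := 3) (L := L) (fundamentalRep (Fin 2)) β') ≤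
          lam⁻¹ * ∫ x, (G x - ∫ z, G z ∂(wilsonMeasure (d := 3) (L := L) (fundamentalRep (Fin 2)) β')) ^ 2
            ∂(wilsonMeasure (d := 3) (L := L) (fundamentalRep (Fin 2)) β')] := by
  tfae_have 1 → 2 := fun h1 => ⟨1, one_pos, fun G hG => h1 G hG 1⟩
  tfae_have 2 → 3 := fun h2 G hG η hη => by
    obtain ⟨h₀, hh₀, hC⟩ := h2
    exact semigroupPoincare_of_contraction_at L β' κ hreal hh₀ hC hG hη
  tfae_have 3 → 1 := fun h3 G hG t =>
    integral_sq_transition_sub_le_exp_of_semigroupPoincare L β' κ hreal h3 hG t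
  tfae_have 1 → 4 := fun h1 G hG T' hT' =>
    autocorrelation_integral_le_of_integral_sq_transition_sub_le_exp L β' κ hreal hlam h1 hG hT'
  tfae_have 4 → 3 := fun h4 G hG η hη => by
    have h := semigroupPoincare_of_autocorrelation_integral_le L β' κ hreal (inv_pos.2 hlam) h4 hG hη
    rw [inv_inv] at h
    exact h
  tfae_finish

end Summit.QuantumFields.YangMills.Theorems.ColdStartUniversality

end
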